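import Summits.AtomisticToContinuum.HydrodynamicLimit.Theses.RelayRaceLocality
import Summits.AtomisticToContinuum.HydrodynamicLimit.Theorems.TwoClocksEntropyToHydro
import HarnessLib

/-!
# Crux `NearConstantShortTimeHL` (stmt-AtomisticToContinuum-12502), line `Sketch` — stub `stub_entropyToLLN`

Support file for the crux `…Theses.RelayRaceLocality.NearConstantShortTimeHL`, line `Sketch` (card
`fejer-isometry-window-transfer`): the registered stub `stub_entropyToLLN : NearConstantRelEntropy → NearConstantShortTimeHL`
— the LAST step of the line: the entropy inequality for events turns relative entropy `o(n_N)` with respect to an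
exponentially concentrating reference into the law of large numbers at time `t` — with the typed Yau-form target
`NearConstantRelEntropy` declared verbatim from the lead's registered skeleton.

PROOF. (1) For an admissible family (`ε_N > 0`, `ε_N → 0`, `n_N ε_N³ → σ³ > 0`) the particle number diverges:
`n_N = (n_N ε_N³) · (ε_N³)⁻¹ → ∞` (`tendsto_atTop_of_tendsto_mul_pow_three`). (2) The sequence form of the entropy
inequality for events with a GENERAL size parameter `m_N → ∞` in place of the conjunct's `N + 1`
(`tendsto_measure_of_klDiv_div_natCast_tendsto_zero`; same proof as
`Theorems.tendsto_measure_of_klDiv_div_tendsto_zero`: `L_N = m_N/(2C)` in `Theorems.measureReal_mul_le_toReal_klDiv_add`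
gives `μ_N(A_N) ≤ 2C·KL_N/m_N + 2C²e^{-m_N/(2C)} → 0` on the `ν_N`-measurable hull of `A_N`; `KL_N = ∞` at small `N` is
excluded eventually by `KL_N/m_N → 0`, and `m_N = 0` by `m_N ≥ 1` eventually). (3) The flow enters only through
`P_N{z | Φ_N t z ∈ A} ≤ ((Φ_N t)_* P_N)(A)` (`HardSphereFlow.lawAt_eq`, `Measure.le_map_apply`,
`HardSphereFlow.measurable_flow`; no measurability of the deviation events is needed; `(Φ_N t)_* P_N` is finite because
`P_N` is a probability measure by hypothesis). (4) The prefix of the crux is threaded with the SAME witnesses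
(`η₀`; `δ₀, τ₀` for each `M`; `σ₀` for each profile), as in `Theorems.relayRaceLocality_nearConstantCore`.

References: H.-T. Yau, Lett. Math. Phys. 22 (1991) §2; C. Kipnis – C. Landim, *Scaling Limits of Interacting Particle
Systems* (1999), Ch. 6 §1 and App. 1 §8; S. Olla – S.R.S. Varadhan – H.-T. Yau, Comm. Math. Phys. 155 (1993) §3.
Not here: any of the other three stubs of the line (`stub_kineticInput`, `stub_windowTransfer`, `stub_nearConstantLedger`).
-/

noncomputable section

namespace Summit.AtomisticToContinuum.HydrodynamicLimit.Theorems.NearConstantShortTimeHL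

open scoped BigOperators ENNReal
open MeasureTheory Set Filter
open Literature.MathematicalPhysics.KineticTheory Literature.Analysis.FluidPDE Literature.Analysis.FunctionSpaces
open Summit.AtomisticToContinuum.HydrodynamicLimit.Theses.RelayRaceLocality (NearConstantShortTimeHL)

/-! ## §1 The typed Yau-form target of the line (verbatim from the registered skeleton) -/

/-- **THE YAU-FORM TARGET IN THE CRUX'S FRAME** (`NearConstantShortTimeHL` with its conclusion "LLN at `t`" replaced by
"relative entropy `o(n_N)` with respect to an exponentially concentrating reference"): same prefix as the crux verbatim
(`∃ η₀ ∀ M ∃ δ₀ τ₀ ∀` continuous positive profiles `∃ σ₀ ∀ σ < σ₀ ∀` families `(ε_N → 0, n_N ε_N³ → σ³) ∀` classical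
hs-Euler solutions `δ₀`-close to a constant state at `t = 0 ∀` flows, canonical local Gibbs laws `P_N` probability
measures with LLN at `0`, `∀ t < min T τ₀` under the packing / temperature / drift / `C¹` guards on `[0, t]`), concluding:
there are finite reference laws `Q_N` on `n_N`-particle phase space whose empirical density / momentum / energy fields
concentrate exponentially in `n_N` (`≤ C e^{-n_N/C}`) around `∫χρ(t)`, `∫χρ(t)u(t)`, `∫χE(t)` for every continuous `χ`
and `δ > 0`, and `KL((Φ_N t)_* P_N ‖ Q_N)/n_N → 0`. [cite: Yau1991, §2] [cite: OllaVaradhanYau1993, §3] -/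
@[conjecture] def NearConstantRelEntropy : Prop :=
  ∃ η₀ : ℝ, 0 < η₀ ∧ ∀ M : ℝ, 0 < M → ∃ δ₀ : ℝ, 0 < δ₀ ∧ ∃ τ₀ : ℝ, 0 < τ₀ ∧ ∀ (a₀ θ₀ : T3 → ℝ) (u₀ : T3 → V3), Continuous a₀ → Continuous θ₀ → Continuous u₀ → (∀ x, 0 < a₀ x) → (∀ x, 0 < θ₀ x) → ∃ σ₀ : ℝ, 0 < σ₀ ∧ ∀ σ : ℝ, 0 < σ → σ < σ₀ → ∀ (ε : ℕ → ℝ) (n : ℕ → ℕ), (∀ N, 0 < ε N) → Tendsto ε atTop (nhds 0) → Tendsto (fun N => (n N : ℝ) * ε N ^ 3) atTop (nhds (σ ^ 3)) → ∀ (T : ℝ) (ρ θ : ℝ → T3 → ℝ) (u : ℝ → T3 → V3), IsHardSphereEulerSolution σ T ρ u θ → (∃ (ubar : V3) (θbar : ℝ), ∀ x, |ρ 0 x - 1| ≤ δ₀ ∧ ‖u 0 x - ubar‖ ≤ δ₀ ∧ |θ 0 x - θbar| ≤ δ₀) → ∀ Φ : (N : ℕ) → HardSphereFlow (Torus.geometry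 (Fin 3)) (ε N) (n N), let P : (N : ℕ) → Measure (Config (n N) (Fin 3) T3) := fun N => particleLaw (Φ N) (canonicalDensity (Torus.geometry (Fin 3)) (ε N) (n N) (localGibbsProfile a₀ u₀ θ₀)); (∀ N, IsProbabilityMeasure (P N)) → (∀ χ : T3 → ℝ, Continuous χ → ∀ δ : ℝ, 0 < δ → Tendsto (fun N => P N {z | δ < |empiricalDensityField ((Φ N).flow 0 z) χ - ∫ x, χ x * ρ 0 x|}) atTop (nhds 0) ∧ Tendsto (fun N => P N {z | δ < ‖empiricalMomentumField ((Φ N).flow 0 z) χ - ∫ x, (χ x * ρ 0 x) • u 0 x‖}) atTop (nhds 0) ∧ Tendsto (fun N => P N {z | δ < |empiricalEnergyField ((Φ N).flow 0 z) χ - ∫ x, χ x * totalEnergyDensity (ρ 0 x) (u 0 x) (θ 0 x)|}) atTop (nhds 0)) → ∀ t ∈ Set.Ico 0 (min T τ₀), (∀ s ∈ Set.Icc 0 t, ∀ x, ρ s x * σ ^ 3 < η₀ ∧ θ s x ≤ M ∧ M⁻¹ ≤ θ s x ∧ ‖u s x‖ ≤ M ∧ ∀ i : Fin 3, |Torus.partialDeriv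 i (ρ s) x| ≤ M ∧ ‖Torus.partialDeriv i (u s) x‖ ≤ M ∧ |Torus.partialDeriv i (θ s) x| ≤ M) → ∃ Q : (N : ℕ) → Measure (Config (n N) (Fin 3) T3), (∀ N, IsFiniteMeasure (Q N)) ∧ (∀ χ : T3 → ℝ, Continuous χ → ∀ δ : ℝ, 0 < δ → ∃ C : ℝ, 0 < C ∧ ∀ N : ℕ, Q N {z | δ < |empiricalDensityField z χ - ∫ x, χ x * ρ t x|} ≤ ENNReal.ofReal (C * Real.exp (-(C⁻¹ * (n N : ℝ)))) ∧ Q N {z | δ < ‖empiricalMomentumField z χ - ∫ x, (χ x * ρ t x) • u t x‖} ≤ ENNReal.ofReal (C * Real.exp (-(C⁻¹ * (n N : ℝ)))) ∧ Q N {z | δ < |empiricalEnergyField z χ - ∫ x, χ x * totalEnergyDensity (ρ t x) (u t x) (θ t x)|} ≤ ENNReal.ofReal (C * Real.exp (-(C⁻¹ * (n N : ℝ))))) ∧ Tendsto (fun N : ℕ => InformationTheory.klDiv ((Φ N).lawAt (P N) t) (Q N) / (n N : ENNReal)) atTop (nhds 0)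

/-! ## §2 Tools: divergence of the particle number; the entropy inequality for events, sequence form with a general size -/

open scoped Topology
open InformationTheory

/-- **The particle number of an admissible family diverges**: if `ε_N > 0`, `ε_N → 0` and `n_N ε_N³ → σ³` with `σ > 0`,
then `n_N → ∞` — because `n_N = (n_N ε_N³) · (ε_N³)⁻¹` with the first factor tending to `σ³ > 0` and the second to `+∞`
(`Filter.Tendsto.pos_mul_atTop`, `tendsto_inv_nhdsGT_zero`). [folklore] -/
theorem tendsto_atTop_of_tendsto_mul_pow_three {ε : ℕ → ℝ} {n : ℕ → ℕ} {σ : ℝ} (hσ : 0 < σ)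
    (hε : ∀ N, 0 < ε N) (hε0 : Tendsto ε atTop (nhds 0))
    (hn : Tendsto (fun N => (n N : ℝ) * ε N ^ 3) atTop (nhds (σ ^ 3))) :
    Tendsto n atTop atTop := by
  have h3 : Tendsto (fun N => ε N ^ 3) atTop (𝓝[>] 0) := by
    refine tendsto_nhdsWithin_iff.mpr ⟨?_, Eventually.of_forall fun N => pow_pos (hε N) 3⟩
    simpa using hε0.pow 3
  have hinv : Tendsto (fun N => (ε N ^ 3)⁻¹) atTop atTop := tendsto_inv_nhdsGT_zero.comp h3
  have hprod := hn.pos_mul_atTop (pow_pos hσ 3) hinv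
  refine (tendsto_natCast_atTop_iff (R := ℝ)).mp (hprod.congr fun N => ?_)
  exact mul_inv_cancel_right₀ (pow_ne_zero 3 (hε N).ne') _

/-- **Relative entropy `o(m_N)` + exponential concentration of the reference at rate `m_N` ⟹ convergence in
probability**, for a general size parameter `m_N → ∞` (the conjunct's version
`Theorems.tendsto_measure_of_klDiv_div_tendsto_zero` is `m_N = N + 1`). For finite measures `μ_N, ν_N` on arbitrary
measurable spaces and arbitrary sets `A_N`: if `ν_N(A_N) ≤ C e^{-m_N/C}` for all `N` and `KL(μ_N ‖ ν_N)/m_N → 0`, then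
`μ_N(A_N) → 0`. Proof: replace `A_N` by its `ν_N`-measurable hull and apply the entropy inequality for events
(`Theorems.measureReal_mul_le_toReal_klDiv_add`) with `L_N = m_N/(2C)`, for the eventual `N` with `KL_N < ∞` and
`m_N ≥ 1`: `μ_N(A_N) ≤ 2C·KL_N/m_N + 2C²·e^{-m_N/(2C)} → 0`. [cite: KipnisLandim1999, Ch. 6 §1] -/
theorem tendsto_measure_of_klDiv_div_natCast_tendsto_zero {Ω : ℕ → Type*} [∀ N, MeasurableSpace (Ω N)]
    (μ ν : ∀ N, Measure (Ω N)) [∀ N, IsFiniteMeasure (μ N)] [∀ N, IsFiniteMeasure (ν N)]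
    (A : ∀ N, Set (Ω N)) {m : ℕ → ℕ} (hm : Tendsto m atTop atTop) {C : ℝ} (hC : 0 < C)
    (hconc : ∀ N : ℕ, ν N (A N) ≤ ENNReal.ofReal (C * Real.exp (-(C⁻¹ * (m N : ℝ)))))
    (hkl : Tendsto (fun N : ℕ => klDiv (μ N) (ν N) / (m N : ℝ≥0∞)) atTop (𝓝 0)) :
    Tendsto (fun N : ℕ => μ N (A N)) atTop (𝓝 0) := by
  -- real-valued relative entropy and its normalisation by the size parameter
  set k : ℕ → ℝ := fun N => (klDiv (μ N) (ν N)).toReal with hk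
  have hk_tendsto : Tendsto (fun N : ℕ => k N / (m N : ℝ)) atTop (𝓝 0) := by
    have h := (ENNReal.tendsto_toReal ENNReal.zero_ne_top).comp hkl
    rw [ENNReal.toReal_zero] at h
    refine h.congr' (Eventually.of_forall fun N => ?_)
    simp only [Function.comp_apply, hk]
    rw [ENNReal.toReal_div, ENNReal.toReal_natCast]
  -- eventually the relative entropy is finite
  have hfin : ∀ᶠ N : ℕ in atTop, klDiv (μ N) (ν N) ≠ ∞ := by
    filter_upwards [hkl.eventually (gt_mem_nhds zero_lt_one)] with N hN
    intro htop
    rw [htop, ENNReal.top_div_of_ne_top (ENNReal.natCast_ne_top _)] at hN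
    exact absurd hN (by simp)
  -- eventually the size parameter is at least one; it diverges as a real sequence
  have hm1 : ∀ᶠ N : ℕ in atTop, 1 ≤ m N := hm.eventually_ge_atTop 1
  have hmR : Tendsto (fun N : ℕ => (m N : ℝ)) atTop atTop := tendsto_natCast_atTop_atTop.comp hm
  -- the real upper bound and its limit
  set B : ℕ → ℝ := fun N =>
    2 * C * (k N / (m N : ℝ)) + 2 * C ^ 2 * Real.exp (-((m N : ℝ) / (2 * C))) with hB
  have hB_tendsto : Tendsto B atTop (𝓝 0) := by
    have h1 : Tendsto (fun N : ℕ => 2 * C * (k N / (m N : ℝ))) atTop (𝓝 0) := by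
      simpa using hk_tendsto.const_mul (2 * C)
    have h2 : Tendsto (fun N : ℕ => 2 * C ^ 2 * Real.exp (-((m N : ℝ) / (2 * C)))) atTop (𝓝 0) := by
      have hdiv : Tendsto (fun N : ℕ => (m N : ℝ) / (2 * C)) atTop atTop :=
        hmR.atTop_div_const (by positivity)
      have hexp := Real.tendsto_exp_neg_atTop_nhds_zero.comp hdiv
      simpa using hexp.const_mul (2 * C ^ 2)
    simpa using h1.add h2
  have hB_ennreal : Tendsto (fun N => ENNReal.ofReal (B N)) atTop (𝓝 0) := by
    simpa using ENNReal.tendsto_ofReal hB_tendsto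
  -- the eventual pointwise bound `μ_N(A_N) ≤ B_N`
  have hbound : ∀ᶠ N : ℕ in atTop, μ N (A N) ≤ ENNReal.ofReal (B N) := by
    filter_upwards [hfin, hm1] with N hN hN1
    set A' : Set (Ω N) := toMeasurable (ν N) (A N) with hA'
    have hA'm : MeasurableSet A' := measurableSet_toMeasurable _ _
    have hm1R : (1 : ℝ) ≤ (m N : ℝ) := by exact_mod_cast hN1
    have hmpos : (0 : ℝ) < (m N : ℝ) := by linarith
    have hm0 : (m N : ℝ) ≠ 0 := hmpos.ne'
    have hC0 : C ≠ 0 := hC.ne'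
    set L : ℝ := (m N : ℝ) / (2 * C) with hL
    have hLpos : 0 < L := by positivity
    -- reference mass of the hull
    have hq : (ν N).real A' ≤ C * Real.exp (-(C⁻¹ * (m N : ℝ))) := by
      rw [measureReal_def, hA', measure_toMeasurable]
      exact ENNReal.toReal_le_of_le_ofReal (by positivity) (hconc N)
    have hq0 : 0 ≤ (ν N).real A' := measureReal_nonneg
    -- entropy inequality for the event `A'`
    have hent := measureReal_mul_le_toReal_klDiv_add hN hA'm L
    have hexpL : (Real.exp L - 1) * (ν N).real A' ≤ C * Real.exp (-((m N : ℝ) / (2 * C))) := by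
      calc (Real.exp L - 1) * (ν N).real A'
          ≤ Real.exp L * (ν N).real A' := by
            apply mul_le_mul_of_nonneg_right (by linarith [Real.exp_pos L]) hq0
        _ ≤ Real.exp L * (C * Real.exp (-(C⁻¹ * (m N : ℝ)))) :=
            mul_le_mul_of_nonneg_left hq (Real.exp_pos L).le
        _ = C * (Real.exp L * Real.exp (-(C⁻¹ * (m N : ℝ)))) := by ring
        _ = C * Real.exp (-((m N : ℝ) / (2 * C))) := by
            have hLid : L + -(C⁻¹ * (m N : ℝ)) = -((m N : ℝ) / (2 * C)) := by
              rw [hL]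
              field_simp
              ring
            rw [← Real.exp_add, hLid]
    have hμ0 : 0 ≤ (μ N).real A' := measureReal_nonneg
    have hk0 : 0 ≤ k N := ENNReal.toReal_nonneg
    have hmain : (μ N).real A' * L ≤ k N + C * Real.exp (-((m N : ℝ) / (2 * C))) := by
      simp only [hk]
      linarith
    have hmB : (μ N).real A' ≤ B N := by
      have h1 : (μ N).real A' ≤ (k N + C * Real.exp (-((m N : ℝ) / (2 * C)))) / L :=
        (le_div_iff₀ hLpos).mpr hmain
      have h2 : (k N + C * Real.exp (-((m N : ℝ) / (2 * C)))) / L =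
          2 * C * (k N / (m N : ℝ)) + 2 * C ^ 2 * Real.exp (-((m N : ℝ) / (2 * C))) / (m N : ℝ) := by
        rw [hL]
        field_simp
      have h3 : 2 * C ^ 2 * Real.exp (-((m N : ℝ) / (2 * C))) / (m N : ℝ) ≤
          2 * C ^ 2 * Real.exp (-((m N : ℝ) / (2 * C))) :=
        div_le_self (by positivity) hm1R
      rw [hB]
      linarith
    calc μ N (A N) ≤ μ N A' := measure_mono (subset_toMeasurable _ _)
      _ = ENNReal.ofReal ((μ N).real A') := (ofReal_measureReal (measure_ne_top _ _)).symm
      _ ≤ ENNReal.ofReal (B N) := ENNReal.ofReal_le_ofReal hmB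
  exact tendsto_of_tendsto_of_tendsto_of_le_of_le' tendsto_const_nhds hB_ennreal
    (Eventually.of_forall fun N => zero_le) hbound

/-! ## §3 The registered stub -/

/-- **S4 — entropy inequality ⇒ LLN at `t`, general families** (registered stub `stub_entropyToLLN` of line `Sketch`):
`NearConstantRelEntropy → NearConstantShortTimeHL`. The prefix of the crux is threaded with the same witnesses; at the
innermost point, for a fixed family `(ε_N, n_N)`, Euler solution, flows `Φ_N`, time `t`, test function `χ` and `δ > 0`,
the reference laws `Q_N` concentrate exponentially in `n_N` and `KL((Φ_N t)_* P_N ‖ Q_N)/n_N → 0` with `n_N → ∞`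
(`tendsto_atTop_of_tendsto_mul_pow_three`), so `((Φ_N t)_* P_N)(deviation at t) → 0`
(`tendsto_measure_of_klDiv_div_natCast_tendsto_zero`), and `P_N{z | Φ_N t z deviates} ≤ ((Φ_N t)_* P_N){deviates}`
(`Measure.le_map_apply`, `HardSphereFlow.measurable_flow`). [cite: Yau1991, §2] -/
theorem stub_entropyToLLN : NearConstantRelEntropy → NearConstantShortTimeHL := by
  intro hRE
  obtain ⟨η₀, hη₀, H⟩ := hRE
  refine ⟨η₀, hη₀, fun M hM => ?_⟩
  obtain ⟨δ₀, hδ₀, τ₀, hτ₀, H1⟩ := H M hM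
  refine ⟨δ₀, hδ₀, τ₀, hτ₀, fun a₀ θ₀ u₀ ha hθ hu ha0 hθ0 => ?_⟩
  obtain ⟨σ₀, hσ₀, H2⟩ := H1 a₀ θ₀ u₀ ha hθ hu ha0 hθ0
  refine ⟨σ₀, hσ₀, ?_⟩
  intro σ hσ hσ' ε n hε hε0 hn T ρ θ u hE hnc Φ P hP h0 t ht hg χ hχ δ hδ
  obtain ⟨Q, hQfin, hconc, hkl⟩ := H2 σ hσ hσ' ε n hε hε0 hn T ρ θ u hE hnc Φ hP h0 t ht hg
  obtain ⟨C, hC, hCN⟩ := hconc χ hχ δ hδ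
  have hn_top : Tendsto n atTop atTop := tendsto_atTop_of_tendsto_mul_pow_three hσ hε hε0 hn
  -- the laws at time `t`, their finiteness, and the transfer inequality along the flow
  haveI : ∀ N, IsFiniteMeasure (Q N) := hQfin
  haveI : ∀ N, IsFiniteMeasure ((Φ N).lawAt (P N) t) := fun N => by
    haveI := hP N
    rw [HardSphereFlow.lawAt_eq]
    infer_instance
  have htransfer : ∀ (N : ℕ) (A : Set (Config (n N) (Fin 3) T3)),
      P N {z | (Φ N).flow t z ∈ A} ≤ (Φ N).lawAt (P N) t A := fun N A => by
    rw [HardSphereFlow.lawAt_eq]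
    exact Measure.le_map_apply ((Φ N).measurable_flow t).aemeasurable A
  have key : ∀ A : ∀ N : ℕ, Set (Config (n N) (Fin 3) T3),
      (∀ N : ℕ, Q N (A N) ≤ ENNReal.ofReal (C * Real.exp (-(C⁻¹ * (n N : ℝ))))) →
      Tendsto (fun N : ℕ => P N {z | (Φ N).flow t z ∈ A N}) atTop (𝓝 0) := fun A hA => by
    have h := tendsto_measure_of_klDiv_div_natCast_tendsto_zero (fun N => (Φ N).lawAt (P N) t) Q A
      hn_top hC hA hkl
    exact tendsto_of_tendsto_of_tendsto_of_le_of_le tendsto_const_nhds h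
      (fun N => zero_le) (fun N => htransfer N (A N))
  refine ⟨?_, ?_, ?_⟩
  · exact key (fun N => {z | δ < |empiricalDensityField z χ - ∫ x, χ x * ρ t x|})
      (fun N => (hCN N).1)
  · exact key (fun N => {z | δ < ‖empiricalMomentumField z χ - ∫ x, (χ x * ρ t x) • u t x‖})
      (fun N => (hCN N).2.1)
  · exact key (fun N => {z | δ < |empiricalEnergyField z χ -
        ∫ x, χ x * totalEnergyDensity (ρ t x) (u t x) (θ t x)|}) (fun N => (hCN N).2.2)

end Summit.AtomisticToContinuum.HydrodynamicLimit.Theorems.NearConstantShortTimeHL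

end
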